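import Summits.CriticalPhenomena.CardyFormulaZ2.Theses.CardySelfDualSegment
import Summits.CriticalPhenomena.CardyFormulaZ2.Theorems.CardySelfDualSegmentUniformBoxCrossingOfMonotoneChirality
import HarnessLib

/-!
# `UniformBoxCrossing` (stmt-CriticalPhenomena-5476) — line `endpoint_halves` (crux-strategist s1, 2026-08-17)

An ALTERNATIVE REGISTRATION of the lead's line `Sketch` (monotone-chirality composition, lead c4/c5), in
which the single kernel `stub_endpointDomination` (a conjunction) is cut into its two differently-anchored
halves, so that stub-level machinery (TTRL narrow/library, stub workers, the standing disprover) works the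
two research statements separately:

* `stub_endpointDominationU` — anchored at the SMIRNOV endpoint `t = 0` (site percolation on the
  triangular lattice of corners, `cornerPercolation_zero`): for every `t ∈ [0,1]`, u-crossings (along
  `hgt = x₀ + x₁`) of the turned `m × 2m` boxes are at least as likely under `M_t` as under `M_0`,
  eventually in `m`, at every integer position (diamond drawing `zDia`). Tools available at the anchor:
  full scaling limit / SLE₆ / discrete holomorphic observables / the Chelkak–Glazman–Smirnov discrete
  stress tensor; its `t = 0⁺` germ is a one-sided derivative of a site-`𝕋` crossing probability under
  "splitting" a density `t/2` of sites; the atomic per-(environment, corner) form is exact for `m ≤ 3`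
  but FALSE from `m = 5` (strategist kit j024047), as it is for W from `m = 3`: only summed forms hold.
* `stub_endpointDominationW` — anchored at the BOND-`ℤ²` endpoint `t = 1` (`cornerPercolation_one`): for
  every `t ∈ [0,1]`, w-crossings (along `col = x₀ - x₁`) of the turned `2m × m` boxes are at least as
  likely under `M_t` as under `M_1`. Equivalent/sufficient forms live inside critical bond-`ℤ²` alone
  (KERNEL-DOSSIER-c5 §2.3: agreement-conditioning `∀ T, P_{1/2}(W | corners of T agree) ≥ P_{1/2}(W)`,
  ψ-monotonicity; smallest open instance ONE corner, `E_{1/2}[σ_E σ_N | W] ≥ 0`, with the D4 symmetry of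
  bond-`ℤ²` available); the atomic per-(environment, corner) form is FALSE at `m = 3` (c5 §1.2).

`UniformBoxCrossing_of` is glue only: the two halves re-assembled into endpoint domination and fed to the
landed `uniformBoxCrossing_of_endpointDomination` (p139614: endpoint inputs `stub_diagW_one`,
`stub_diagU_zero_site`/`_dict`, chaining `stub_diagChain`, zig-zag `stub_hardWay_of_diag`, Bollobás–Riordan
tail `stub_glue → stub_upper → stub_render`, all landed). A route-file-free version of the same glue
(`uniformBoxCrossing_of_endpointDominationU_W`, for a future `route edit --split … --glue-by`) is attached to
the item as evidence `CardySelfDualSegmentUniformBoxCrossingSplit.lean` (lean check rc 0).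

This file is PUBLISHED but deliberately NOT registered by the strategist seat (registration would replace
the lead's live skeleton); the lead may `ledger skeleton check` it at a cycle boundary. See
`Lines/endpoint_halves.md` and `STRATEGY-CENSUS.md` in this directory.
-/

namespace Summit.CriticalPhenomena.CardyFormulaZ2.Cruxes.UniformBoxCrossing.EndpointHalves

open MeasureTheory Complex Literature.Probability.Percolation Literature.Probability.LatticeModels
open Literature.Probability.Percolation.TrackExchange
open Summit.CriticalPhenomena.CardyFormulaZ2.Theses.CardySelfDualSegment
open Summit.CriticalPhenomena.CardyFormulaZ2.Cruxes.UniformBoxCrossing.NonSlantLine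

/-! ### The stubs -/

/-- **Stub 1 (research, Smirnov-anchored): endpoint domination, u-half.** There is `m₁` such that for
every `m ≥ m₁`, every integer position `(A, B)` (diamond coordinates) and every `t ∈ [0,1]`, the
`M_t`-probability of a u-crossing of the turned box `[A, A+m]_col × [B, B+2m]_hgt` is at least its
`M_0`-probability (site-`𝕋` end): untying corners of site-`𝕋` never lowers u-connectivity; the
large-scale anisotropy satisfies `λ_t ≤ λ_0 = √3`. Natural stronger form: `t ↦ P_t(U)` non-decreasing
(monotone chirality, exact for `m ≤ 3`, Monte Carlo `m ≤ 1024`). -/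
theorem stub_endpointDominationU :
    ∃ m₁ : ℕ, ∀ m : ℕ, m₁ ≤ m → ∀ (A B : ℤ) (t : unitInterval),
      (cornerPercolation 0).real (embTBCrossing (fun v => zDia v - ((A : ℂ) + (B : ℂ) * I)) m (2 * m)) ≤
        (cornerPercolation t).real (embTBCrossing (fun v => zDia v - ((A : ℂ) + (B : ℂ) * I)) m (2 * m)) := by
  sorry

/-- **Stub 2 (research, bond-`ℤ²`-anchored): endpoint domination, w-half.** There is `m₁` such that
for every `m ≥ m₁`, every integer position `(A, B)` and every `t ∈ [0,1]`, the `M_t`-probability of a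
w-crossing of the turned box `[A, A+2m]_col × [B, B+m]_hgt` is at least its `M_1`-probability
(`P_{1/2}` bond-`ℤ²` end): tying NE-corners of critical bond-`ℤ²` never lowers hard-way w-crossings;
`λ_t ≥ λ_1 = 1`. Natural stronger form: `t ↦ P_t(W)` non-increasing; cleanest research form inside
bond-`ℤ²`: agreement-conditioning never lowers `P_{1/2}(W)` (KERNEL-DOSSIER-c5 §2.3). -/
theorem stub_endpointDominationW :
    ∃ m₁ : ℕ, ∀ m : ℕ, m₁ ≤ m → ∀ (A B : ℤ) (t : unitInterval),
      (cornerPercolation 1).real (embRectCrossing (fun v => zDia v - ((A : ℂ) + (B : ℂ) * I)) (2 * m) m) ≤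
        (cornerPercolation t).real (embRectCrossing (fun v => zDia v - ((A : ℂ) + (B : ℂ) * I)) (2 * m) m) := by
  sorry

/-! ### The crux from the stubs -/

/-- The two halves re-assembled into ENDPOINT DOMINATION (the lead's kernel `stub_endpointDomination`,
conjunction form), with a common eventual-in-`m` threshold. -/
theorem endpointDomination_of_halves :
    ∃ m₁ : ℕ, ∀ m : ℕ, m₁ ≤ m → ∀ (A B : ℤ) (t : unitInterval),
      (cornerPercolation 0).real (embTBCrossing (fun v => zDia v - ((A : ℂ) + (B : ℂ) * I)) m (2 * m)) ≤
        (cornerPercolation t).real (embTBCrossing (fun v => zDia v - ((A : ℂ) + (B : ℂ) * I)) m (2 * m)) ∧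
      (cornerPercolation 1).real (embRectCrossing (fun v => zDia v - ((A : ℂ) + (B : ℂ) * I)) (2 * m) m) ≤
        (cornerPercolation t).real (embRectCrossing (fun v => zDia v - ((A : ℂ) + (B : ℂ) * I)) (2 * m) m) := by
  obtain ⟨m₁, hU⟩ := stub_endpointDominationU
  obtain ⟨m₂, hW⟩ := stub_endpointDominationW
  exact ⟨max m₁ m₂, fun m hm A B t =>
    ⟨hU m ((le_max_left _ _).trans hm) A B t, hW m ((le_max_right _ _).trans hm) A B t⟩⟩

/-- **The crux from the stubs**: `UniformBoxCrossing`, by the landed composition of line `Sketch`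
(`uniformBoxCrossing_of_endpointDomination`, p139614) applied to the re-assembled endpoint domination. -/
theorem UniformBoxCrossing_of : UniformBoxCrossing :=
  uniformBoxCrossing_of_endpointDomination endpointDomination_of_halves

end Summit.CriticalPhenomena.CardyFormulaZ2.Cruxes.UniformBoxCrossing.EndpointHalves
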